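import Summits.ResolutionOfSingularities.ResolutionOfSingularities.Theorems.FrobeniusLadderFInjectiveMacaulayficationRelGddF192Cone
import Summits.ResolutionOfSingularities.ResolutionOfSingularities.Theorems.FrobeniusLadderFInjectiveMacaulayficationRelGddF021Data
import Mathlib.Algebra.CharP.Algebra
import Mathlib.Tactic.LinearCombination
import HarnessLib

/-!
# ROWC row F021 at `p = 5`: the CONE clause OFF THE BAD ORBIT `O = {x = y = z = t = 0}` (clone of `…RelGddF211Cone` / `…RelGddF192Cone`)
# (crux `FInjectiveMacaulayfication` stmt-ResolutionOfSingularities-15315, engine v2 `FilteredConeFiModelRelDirect`; RULING R16.30 (5) of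
# res-L1-w45a-plan-1: third clone of the facet template)

Support file, chain w45a, seat res-L1-w45a-stub-4 g6. [OURS · L1 W4.5a] — NOT a statement of the manuscript; AI-written, weaker than
expert review.

`g₀ = z² + t⁴y²w⁴ + (y² + x³)³ + y⁴w²` (`x,y,z,w,t = X₀,…,X₄`, `φ = y² + x³`), the `(2,3,9,3 | 0)`-cone of F021's diagonal form.
Off `V(x,y,z,w)` its non-regular closed points lie on TWO strata (`cone_strata_of_jacobian`, a residue-domain chain: `∂_z = 2z`;
`y = 0` forces `x = 0` (`g₀`); for `y ≠ 0`, `∂_t = 4t³y²w⁴` gives `t = 0` or `w = 0`; `w = 0` gives `φ = 0` (`∂_y`), and `t = 0`,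
`w ≠ 0` makes `∂_w = 2y²w(2t⁴w² + y²)` read `2y⁴w = 0` — absurd):
* `S₀ = {x = y = z = 0}`: `w ∉ P` (some `x̄ⱼ ∉ Q`), `t ∉ P` (off `O`); slices `x,y,z`, witness `y⁴z⁴`, coefficient `6(t⁴w⁴)²`
  (`coeff_S0e` — the term `C(w²)Y⁴` only contributes in `Y`-degree `≥ 6` to the square);
* `S₁ = {z = w = 0, φ = 0}` (`t` free), `y ∉ P`: slices `z,w` (base `k[x,y,t]`), witness `z⁴w⁴`, coefficient
  `6·(2t⁴y²φ³ + y⁸)` (`coeff_S1w`) — NOT of the shape unit·`φ^m`, but itself `∉ 𝔭` since `φ ∈ 𝔭 ∌ y`: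
  `FedderViaSlicing.clause_of_sliceCoeff` with `m = 1`.
No definitions, no named facts. [folklore]
-/

-- single-problem summit: the doubled namespace component is forced
set_option linter.dupNamespace false

noncomputable section

namespace Summit.ResolutionOfSingularities.ResolutionOfSingularities.Theorems.FInjectiveMacaulayfication.RelGddF021Cone

open MvPolynomial IsLocalRing
open Summit.ResolutionOfSingularities.ResolutionOfSingularities.Theorems.FInjectiveMacaulayfication

/-- **Stratum `S₀ = {x=y=z=0}` for F021's cone: the `x⁰y⁴z⁴`-coefficient of `g₀⁴` is `6·a²`, `a = t⁴w⁴`** (slices `x,y,z`; the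
term `C(e)Y⁴ = y⁴w²` contributes to the square only in `Y`-degree `≥ 6`). [folklore] -/
theorem coeff_S0e (k : Type) [Field k] (a e : MvPolynomial (Fin 2) k) :
    coeff (Finsupp.single (2 : Fin 3) (2 * 2) + Finsupp.single 1 4)
      ((X 2 ^ 2 + (C a * X 1 ^ 2 + (X 1 ^ 2 + X 0 ^ 3) ^ 3 + C e * X 1 ^ 4) : MvPolynomial (Fin 3) (MvPolynomial (Fin 2) k)) ^ 4) =
        6 * a ^ 2 := by
  set u : MvPolynomial (Fin 3) (MvPolynomial (Fin 2) k) := C a * X 1 ^ 2 + (X 1 ^ 2 + X 0 ^ 3) ^ 3 + C e * X 1 ^ 4 with hu_def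
  have hXdeg : ∀ (j : Fin 3), j ≠ 2 → ∀ n : ℕ, degreeOf 2 (X j ^ n : MvPolynomial (Fin 3) (MvPolynomial (Fin 2) k)) = 0 := by
    intro j hj n
    apply Nat.eq_zero_of_le_zero
    refine (degreeOf_pow_le _ _ _).trans ?_
    rw [degreeOf_X, if_neg hj.symm, mul_zero]
  have hφdeg : degreeOf 2 (X 1 ^ 2 + X 0 ^ 3 : MvPolynomial (Fin 3) (MvPolynomial (Fin 2) k)) = 0 := by
    apply Nat.eq_zero_of_le_zero
    refine (degreeOf_add_le _ _ _).trans (max_le ?_ ?_)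
    · rw [hXdeg 1 (by decide)]
    · rw [hXdeg 0 (by decide)]
  have hu : degreeOf 2 u = 0 := by
    apply Nat.eq_zero_of_le_zero
    refine (degreeOf_add_le _ _ _).trans (max_le ((degreeOf_add_le _ _ _).trans (max_le ?_ ?_)) ?_)
    · refine (degreeOf_mul_le _ _ _).trans ?_
      rw [degreeOf_C, hXdeg 1 (by decide)]
    · refine (degreeOf_pow_le _ _ _).trans ?_
      rw [hφdeg, mul_zero]
    · refine (degreeOf_mul_le _ _ _).trans ?_
      rw [degreeOf_C, hXdeg 1 (by decide)]
  rw [FedderViaSlicing.coeff_X_pow_add_pow 2 2 4 2 (by norm_num) (by norm_num) u hu _ (by simp),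
    show (4 - 2 : ℕ) = 2 from rfl, show (Nat.choose 4 2 : MvPolynomial (Fin 2) k) = 6 by norm_num [Nat.choose]]
  congr 1
  have hdvd : (X 0 : MvPolynomial (Fin 3) (MvPolynomial (Fin 2) k)) ^ 1 ∣ u - (C a * X 1 ^ 2 + X 1 ^ 6 + C e * X 1 ^ 4) :=
    ⟨X 0 ^ 2 * (3 * X 1 ^ 4 + 3 * X 1 ^ 2 * X 0 ^ 3 + X 0 ^ 6), by rw [hu_def]; ring⟩
  rw [T4PlusFedderData.coeff_pow_eq_of_X_pow_dvd_sub (Finsupp.single 1 4) 0 1 (by simp) hdvd 2]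
  have hsq : ((C a * X 1 ^ 2 + X 1 ^ 6 + C e * X 1 ^ 4) ^ 2 : MvPolynomial (Fin 3) (MvPolynomial (Fin 2) k)) =
      C (a ^ 2) * X 1 ^ 4 + X 1 ^ 5 * (2 * C a * X 1 ^ 3 + X 1 ^ 7 + 2 * C a * C e * X 1 + 2 * C e * X 1 ^ 5 + C e * C e * X 1 ^ 3) := by
    rw [map_pow]; ring
  rw [hsq, coeff_add, HFedderCertificates.coeff_X_pow_mul_eq_zero _ 1 5 (by simp), add_zero, X_pow_eq_monomial, coeff_C_mul,
    coeff_monomial, if_pos rfl, mul_one]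

/-- **Stratum `S₁ = {z=w=0, φ=0}`: the `Z⁴W⁴`-coefficient of `(Z² + C(b)W⁴ + C(c) + C(e)W²)⁴` is `6·(2bc + e²)`** (`b = t⁴y²`,
`c = φ³`, `e = y⁴`; base `k[x,y,t]`): binomial in `Z`, then the `W⁴`-coefficient of `u²` is `2bc + e²`. [folklore] -/
theorem coeff_S1w (k : Type) [Field k] (b c e : MvPolynomial (Fin 3) k) :
    coeff (Finsupp.single (0 : Fin 2) (2 * 2) + Finsupp.single 1 4)
      ((X 0 ^ 2 + (C b * X 1 ^ 4 + C c + C e * X 1 ^ 2) : MvPolynomial (Fin 2) (MvPolynomial (Fin 3) k)) ^ 4) =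
        6 * (2 * b * c + e ^ 2) := by
  set u : MvPolynomial (Fin 2) (MvPolynomial (Fin 3) k) := C b * X 1 ^ 4 + C c + C e * X 1 ^ 2 with hu_def
  have hXdeg : ∀ n : ℕ, degreeOf 0 (X 1 ^ n : MvPolynomial (Fin 2) (MvPolynomial (Fin 3) k)) = 0 := by
    intro n
    apply Nat.eq_zero_of_le_zero
    refine (degreeOf_pow_le _ _ _).trans ?_
    rw [degreeOf_X, if_neg (by decide), mul_zero]
  have hu : degreeOf 0 u = 0 := by
    apply Nat.eq_zero_of_le_zero
    refine (degreeOf_add_le _ _ _).trans (max_le ((degreeOf_add_le _ _ _).trans (max_le ?_ ?_)) ?_)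
    · refine (degreeOf_mul_le _ _ _).trans ?_
      rw [degreeOf_C, hXdeg]
    · rw [degreeOf_C]
    · refine (degreeOf_mul_le _ _ _).trans ?_
      rw [degreeOf_C, hXdeg]
  rw [FedderViaSlicing.coeff_X_pow_add_pow 0 2 4 2 (by norm_num) (by norm_num) u hu _ (by simp),
    show (4 - 2 : ℕ) = 2 from rfl, show (Nat.choose 4 2 : MvPolynomial (Fin 3) k) = 6 by norm_num [Nat.choose]]
  congr 1
  have hsq : (u ^ 2 : MvPolynomial (Fin 2) (MvPolynomial (Fin 3) k)) =
      X 1 ^ 5 * (C (b ^ 2) * X 1 ^ 3 + C (2 * b * e) * X 1) + C (2 * b * c + e ^ 2) * X 1 ^ 4 + C (2 * c * e) * X 1 ^ 2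
        + C (c ^ 2) := by
    rw [hu_def, map_pow, map_pow, map_add, map_pow, map_mul, map_mul, map_mul, map_mul, map_mul, map_mul, map_ofNat]; ring
  rw [hsq, coeff_add, coeff_add, coeff_add, HFedderCertificates.coeff_X_pow_mul_eq_zero _ 1 5 (by simp), zero_add,
    X_pow_eq_monomial, X_pow_eq_monomial, coeff_C_mul, coeff_C_mul, coeff_monomial, coeff_monomial, if_pos rfl, if_neg, mul_one,
    mul_zero, add_zero, coeff_C, if_neg, add_zero]
  · rw [eq_comm, Finsupp.single_eq_zero]; norm_num
  · intro h
    have h1 := Finsupp.ext_iff.mp h 1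
    simp at h1

/-- **THE RESIDUE-DOMAIN CHAIN FOR THE CONE.** In a domain `R` of characteristic `5`, `g₀ = ∇g₀ = 0` forces `x = y = z = 0`
(stratum `S₀`) or `z = w = 0 ∧ y² + x³ = 0` (stratum `S₁`). [folklore] -/
theorem cone_strata_of_jacobian {R : Type} [CommRing R] [IsDomain R] (h5 : (5 : R) = 0) (x y z w t : R)
    (eg : z ^ 2 + t ^ 4 * y ^ 2 * w ^ 4 + (y ^ 2 + x ^ 3) ^ 3 + y ^ 4 * w ^ 2 = 0)
    (e1 : 2 * t ^ 4 * y * w ^ 4 + 6 * y * (y ^ 2 + x ^ 3) ^ 2 + 4 * y ^ 3 * w ^ 2 = 0)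
    (e2 : 2 * z = 0)
    (e3 : 4 * t ^ 4 * y ^ 2 * w ^ 3 + 2 * y ^ 4 * w = 0)
    (e4 : 4 * t ^ 3 * y ^ 2 * w ^ 4 = 0) :
    (x = 0 ∧ y = 0 ∧ z = 0) ∨ (z = 0 ∧ w = 0 ∧ y ^ 2 + x ^ 3 = 0) := by
  have hz : z = 0 := by linear_combination 3 * e2 - z * h5
  by_cases hy : y = 0
  · refine Or.inl ⟨?_, hy, hz⟩
    have hx9 : x ^ 9 = 0 := by
      linear_combination eg - z * hz - (t ^ 4 * y * w ^ 4 + y ^ 3 * w ^ 2 + y ^ 5 + 3 * y ^ 3 * x ^ 3 + 3 * y * x ^ 6) * hy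
    exact pow_eq_zero_iff (by norm_num) |>.mp hx9
  · right
    by_cases hw : w = 0
    · have f1 : y * (y ^ 2 + x ^ 3) ^ 2 = 0 := by
        linear_combination e1 - y * (y ^ 2 + x ^ 3) ^ 2 * h5 - (2 * t ^ 4 * y * w ^ 3 + 4 * y ^ 3 * w) * hw
      have hφ2 := (mul_eq_zero.mp f1).resolve_left hy
      exact ⟨hz, hw, pow_eq_zero_iff two_ne_zero |>.mp hφ2⟩
    · exfalso
      -- `∂_t`: `t³y² = 0`, so `t = 0`; then `∂_w` reads `2y⁴w = 0`
      have hty : t ^ 3 * y ^ 2 = 0 := by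
        have h : w ^ 4 * (t ^ 3 * y ^ 2) = 0 := by linear_combination 4 * e4 - 3 * t ^ 3 * y ^ 2 * w ^ 4 * h5
        exact (mul_eq_zero.mp h).resolve_left (pow_ne_zero 4 hw)
      have ht : t = 0 := by
        rcases mul_eq_zero.mp hty with h | h
        · exact pow_eq_zero_iff (by norm_num) |>.mp h
        · exact absurd (pow_eq_zero_iff two_ne_zero |>.mp h) hy
      have hyw : y ^ 4 * w = 0 := by linear_combination 3 * e3 - y ^ 4 * w * h5 - 12 * t ^ 3 * y ^ 2 * w ^ 3 * ht
      rcases mul_eq_zero.mp hyw with h | h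
      · exact hy (pow_eq_zero_iff (by norm_num) |>.mp h)
      · exact hw h

set_option maxHeartbeats 400000 in
/-- **THE CONE CLAUSE OFF THE BAD ORBIT for `g₀ = z² + t⁴y²w⁴ + (y² + x³)³ + y⁴w²` at `p = 5`** (F021): at every maximal ideal `Q`
of `k[X]/(g₀)` missing some `x̄ⱼ` (`j ≤ 3`) and not containing all of `x̄₀, x̄₁, x̄₂, x̄₄`, the local ring satisfies the
Cohen–Macaulay + Frobenius-closed clause. [cite: Fedder1983, Thm. 1.12] [cite: Matsumura1987, Thm. 30.4 (ii)] -/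
theorem g0_offO_clause_char5 (k : Type) [Field k] [CharP k 5] (g₀ : MvPolynomial (Fin 5) k)
    (hg : g₀ = X 2 ^ 2 + X 4 ^ 4 * X 1 ^ 2 * X 3 ^ 4 + (X 1 ^ 2 + X 0 ^ 3) ^ 3 + X 1 ^ 4 * X 3 ^ 2) :
    ∀ (Q : Ideal (MvPolynomial (Fin 5) k ⧸ Ideal.span {g₀})) [Q.IsMaximal],
      (∃ j ∈ ({0, 1, 2, 3} : Finset (Fin 5)), Ideal.Quotient.mk (Ideal.span {g₀}) (MvPolynomial.X j) ∉ Q) →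
      ¬ (Ideal.Quotient.mk (Ideal.span {g₀}) (MvPolynomial.X 0) ∈ Q ∧ Ideal.Quotient.mk (Ideal.span {g₀}) (MvPolynomial.X 1) ∈ Q ∧
         Ideal.Quotient.mk (Ideal.span {g₀}) (MvPolynomial.X 2) ∈ Q ∧ Ideal.Quotient.mk (Ideal.span {g₀}) (MvPolynomial.X 4) ∈ Q) →
      ∀ d : ℕ, ringKrullDim (Localization.AtPrime Q) = d → ∀ s : Fin d → Localization.AtPrime Q,
        (Ideal.span (Set.range s)).radical.IsMaximal →
          RingTheory.Sequence.IsWeaklyRegular (Localization.AtPrime Q) (List.ofFn s) ∧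
          ∀ y : Localization.AtPrime Q, (∃ e : ℕ, y ^ 5 ^ e ∈ Ideal.span
            ((fun z : Localization.AtPrime Q => z ^ 5 ^ e) ''
              (Ideal.span (Set.range s) : Set (Localization.AtPrime Q)))) → y ∈ Ideal.span (Set.range s) := by
  haveI : Fact (Nat.Prime 5) := ⟨by norm_num⟩
  intro Q _ hj hO d hd s hs
  haveI hPmax : (Q.comap (Ideal.Quotient.mk (Ideal.span {g₀}))).IsMaximal :=
    Ideal.comap_isMaximal_of_surjective _ Ideal.Quotient.mk_surjective
  have hP := hPmax.isPrime
  have hg0 : g₀ ≠ 0 := hg ▸ RelGddF021Data.g0_ne_zero k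
  have hgP : g₀ ∈ Q.comap (Ideal.Quotient.mk (Ideal.span {g₀})) := by
    rw [Ideal.mem_comap, Ideal.Quotient.eq_zero_iff_mem.mpr (Ideal.mem_span_singleton_self g₀)]
    exact Q.zero_mem
  -- partial derivatives
  have hd0 : pderiv 0 g₀ = 9 * X 0 ^ 2 * (X 1 ^ 2 + X 0 ^ 3) ^ 2 := by rw [hg, RelGddF021Data.pderiv_zero_g0]
  have hd1 : pderiv 1 g₀ = 2 * X 4 ^ 4 * X 1 * X 3 ^ 4 + 6 * X 1 * (X 1 ^ 2 + X 0 ^ 3) ^ 2 + 4 * X 1 ^ 3 * X 3 ^ 2 := by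
    rw [hg, RelGddF021Data.pderiv_one_g0]
  have hd2 : pderiv 2 g₀ = 2 * X 2 := by rw [hg, RelGddF021Data.pderiv_two_g0]
  have hd3 : pderiv 3 g₀ = 4 * X 4 ^ 4 * X 1 ^ 2 * X 3 ^ 3 + 2 * X 1 ^ 4 * X 3 := by rw [hg, RelGddF021Data.pderiv_three_g0]
  have hd4 : pderiv 4 g₀ = 4 * X 4 ^ 3 * X 1 ^ 2 * X 3 ^ 4 := by rw [hg, RelGddF021Data.pderiv_four_g0]
  -- Jacobian exits
  by_cases m0 : pderiv 0 g₀ ∈ Q.comap (Ideal.Quotient.mk (Ideal.span {g₀})); swap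
  · exact ClauseOfPderivNotMem.stub_clauseOfPderivNotMem 5 k 5 g₀ Q 0 m0 d hd s hs
  by_cases m1 : pderiv 1 g₀ ∈ Q.comap (Ideal.Quotient.mk (Ideal.span {g₀})); swap
  · exact ClauseOfPderivNotMem.stub_clauseOfPderivNotMem 5 k 5 g₀ Q 1 m1 d hd s hs
  by_cases m2 : pderiv 2 g₀ ∈ Q.comap (Ideal.Quotient.mk (Ideal.span {g₀})); swap
  · exact ClauseOfPderivNotMem.stub_clauseOfPderivNotMem 5 k 5 g₀ Q 2 m2 d hd s hs
  by_cases m3 : pderiv 3 g₀ ∈ Q.comap (Ideal.Quotient.mk (Ideal.span {g₀})); swap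
  · exact ClauseOfPderivNotMem.stub_clauseOfPderivNotMem 5 k 5 g₀ Q 3 m3 d hd s hs
  by_cases m4 : pderiv 4 g₀ ∈ Q.comap (Ideal.Quotient.mk (Ideal.span {g₀})); swap
  · exact ClauseOfPderivNotMem.stub_clauseOfPderivNotMem 5 k 5 g₀ Q 4 m4 d hd s hs
  -- all partials in `P`: pass to the residue domain `R = k[X] / P` (characteristic `5`)
  haveI : Nontrivial (MvPolynomial (Fin 5) k ⧸ Q.comap (Ideal.Quotient.mk (Ideal.span {g₀}))) :=
    Ideal.Quotient.nontrivial_iff.mpr hPmax.ne_top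
  haveI : CharP (MvPolynomial (Fin 5) k ⧸ Q.comap (Ideal.Quotient.mk (Ideal.span {g₀}))) 5 :=
    charP_of_injective_algebraMap
      (algebraMap k (MvPolynomial (Fin 5) k ⧸ Q.comap (Ideal.Quotient.mk (Ideal.span {g₀})))).injective 5
  have h5 : (5 : MvPolynomial (Fin 5) k ⧸ Q.comap (Ideal.Quotient.mk (Ideal.span {g₀}))) = 0 := by
    simpa using CharP.cast_eq_zero (MvPolynomial (Fin 5) k ⧸ Q.comap (Ideal.Quotient.mk (Ideal.span {g₀}))) 5
  set π := Ideal.Quotient.mk (Q.comap (Ideal.Quotient.mk (Ideal.span {g₀}))) with hπdef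
  have hπ : ∀ a : MvPolynomial (Fin 5) k, a ∈ Q.comap (Ideal.Quotient.mk (Ideal.span {g₀})) → π a = 0 :=
    fun a ha => Ideal.Quotient.eq_zero_iff_mem.mpr ha
  have hπ' : ∀ a : MvPolynomial (Fin 5) k, π a = 0 → a ∈ Q.comap (Ideal.Quotient.mk (Ideal.span {g₀})) :=
    fun a ha => Ideal.Quotient.eq_zero_iff_mem.mp ha
  have eg : π (X 2 ^ 2 + X 4 ^ 4 * X 1 ^ 2 * X 3 ^ 4 + (X 1 ^ 2 + X 0 ^ 3) ^ 3 + X 1 ^ 4 * X 3 ^ 2) = 0 := by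
    rw [← hg]
    exact hπ g₀ hgP
  have e1 := hπ _ m1
  have e2 := hπ _ m2
  have e3 := hπ _ m3
  have e4 := hπ _ m4
  rw [hd1] at e1
  rw [hd2] at e2
  rw [hd3] at e3
  rw [hd4] at e4
  simp only [map_add, map_mul, map_pow, map_ofNat] at eg e1 e2 e3 e4
  have key : ∀ i : Fin 5, (X i : MvPolynomial (Fin 5) k) ∈ Q.comap (Ideal.Quotient.mk (Ideal.span {g₀})) ↔
      Ideal.Quotient.mk (Ideal.span {g₀}) (X i) ∈ Q := fun i => Ideal.mem_comap
  have hu6 : ∀ (σ : Type), IsUnit (6 : MvPolynomial σ k) := fun σ => by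
    simpa using G5wConeClause.isUnit_natCast_of_not_dvd 5 k 6 (by decide)
  rcases cone_strata_of_jacobian h5 (π (X 0)) (π (X 1)) (π (X 2)) (π (X 3)) (π (X 4)) eg e1 e2 e3 e4 with
    ⟨hx, hy, hz⟩ | ⟨hz, hw, hφ⟩
  · /- STRATUM `S₀ = {x=y=z=0}`: then `w ∉ P` (some `x̄ⱼ ∉ Q`) and `t ∉ P` (off `O`); slices `x,y,z`, witness `y⁴z⁴`,
    coefficient `6(t⁴w⁴)²` -/
    have hX0 : (X 0 : MvPolynomial (Fin 5) k) ∈ Q.comap (Ideal.Quotient.mk (Ideal.span {g₀})) := hπ' _ hx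
    have hX1 : (X 1 : MvPolynomial (Fin 5) k) ∈ Q.comap (Ideal.Quotient.mk (Ideal.span {g₀})) := hπ' _ hy
    have hX2 : (X 2 : MvPolynomial (Fin 5) k) ∈ Q.comap (Ideal.Quotient.mk (Ideal.span {g₀})) := hπ' _ hz
    have hX3 : (X 3 : MvPolynomial (Fin 5) k) ∉ Q.comap (Ideal.Quotient.mk (Ideal.span {g₀})) := by
      intro h3
      obtain ⟨j, hjJ, hjQ⟩ := hj
      apply hjQ
      simp only [Finset.mem_insert, Finset.mem_singleton] at hjJ
      rcases hjJ with rfl | rfl | rfl | rfl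
      · exact (key 0).mp hX0
      · exact (key 1).mp hX1
      · exact (key 2).mp hX2
      · exact (key 3).mp h3
    have hX4 : (X 4 : MvPolynomial (Fin 5) k) ∉ Q.comap (Ideal.Quotient.mk (Ideal.span {g₀})) :=
      fun h4 => hO ⟨(key 0).mp hX0, (key 1).mp hX1, (key 2).mp hX2, (key 4).mp h4⟩
    obtain ⟨Ψ, hΨ0, hΨ1, hΨ2, hΨ3, hΨ4⟩ := RelGddF192ConeData.exists_xyzSlicing5 k
    have hy0 : Ψ.symm (X 0) = X 0 := Ψ.symm_apply_eq.mpr hΨ0.symm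
    have hy1 : Ψ.symm (X 1) = X 1 := Ψ.symm_apply_eq.mpr hΨ1.symm
    have hy2 : Ψ.symm (X 2) = X 2 := Ψ.symm_apply_eq.mpr hΨ2.symm
    have hb0 : Ψ.symm (C (X 0)) = X 3 := Ψ.symm_apply_eq.mpr hΨ3.symm
    have hb1 : Ψ.symm (C (X 1)) = X 4 := Ψ.symm_apply_eq.mpr hΨ4.symm
    have hyΨ : ∀ r : Fin 3, Ψ.symm (X r) ∈ Q.comap (Ideal.Quotient.mk (Ideal.span {g₀})) := by
      intro r; fin_cases r
      · exact hy0 ▸ hX0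
      · exact hy1 ▸ hX1
      · exact hy2 ▸ hX2
    have hΨg : Ψ g₀ = X 2 ^ 2 + (C (X 1 ^ 4 * X 0 ^ 4) * X 1 ^ 2 + (X 1 ^ 2 + X 0 ^ 3) ^ 3 + C (X 0 ^ 2) * X 1 ^ 4) := by
      rw [hg]; simp only [map_add, map_mul, map_pow, hΨ0, hΨ1, hΨ2, hΨ3, hΨ4]; ring
    have hcoeff : coeff (Finsupp.single (2 : Fin 3) (2 * 2) + Finsupp.single 1 4) (Ψ (g₀ ^ (5 - 1))) =
        6 * (X 1 ^ 4 * X 0 ^ 4) ^ 2 := by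
      rw [map_pow, hΨg, show (5 - 1 : ℕ) = 4 from rfl, coeff_S0e]
    have hdslice : ∀ r : Fin 3, (Finsupp.single (2 : Fin 3) (2 * 2) + Finsupp.single 1 4 : Fin 3 →₀ ℕ) r < 5 := by
      intro r; fin_cases r <;> simp
    haveI h𝔭 : ((Q.comap (Ideal.Quotient.mk (Ideal.span {g₀}))).comap (Ψ.symm.toRingHom.comp C)).IsPrime := Ideal.comap_isPrime _ _
    have htw : (X 1 ^ 4 * X 0 ^ 4 : MvPolynomial (Fin 2) k) ∉
        (Q.comap (Ideal.Quotient.mk (Ideal.span {g₀}))).comap (Ψ.symm.toRingHom.comp C) := by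
      intro h
      rcases h𝔭.mem_or_mem h with h1 | h0
      · have h1' := Ideal.mem_comap.mp (h𝔭.mem_of_pow_mem 4 h1)
        rw [RingHom.comp_apply, RingEquiv.toRingHom_eq_coe, RingEquiv.coe_toRingHom, hb1] at h1'
        exact hX4 h1'
      · have h0' := Ideal.mem_comap.mp (h𝔭.mem_of_pow_mem 4 h0)
        rw [RingHom.comp_apply, RingEquiv.toRingHom_eq_coe, RingEquiv.coe_toRingHom, hb0] at h0'
        exact hX3 h0'
    exact FedderViaSlicing.clause_of_sliceCoeff 5 k Ψ g₀ hg0 Q hyΨ _ hdslice _ (X 1 ^ 4 * X 0 ^ 4) (hu6 _) 2 (by norm_num) hcoeff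
      (Or.inl htw) d hd s hs
  · /- STRATUM `S₁ = {z=w=0, φ=0}`: `y ∉ P` (else `x ∈ P` too, contradicting `hj`); slices `z,w` (base `k[x,y,t]`), witness `z⁴w⁴`,
    coefficient `6(2t⁴y²φ³ + y⁸) ∉ 𝔭` -/
    have hX2 : (X 2 : MvPolynomial (Fin 5) k) ∈ Q.comap (Ideal.Quotient.mk (Ideal.span {g₀})) := hπ' _ hz
    have hX3 : (X 3 : MvPolynomial (Fin 5) k) ∈ Q.comap (Ideal.Quotient.mk (Ideal.span {g₀})) := hπ' _ hw
    have hφP : (X 1 ^ 2 + X 0 ^ 3 : MvPolynomial (Fin 5) k) ∈ Q.comap (Ideal.Quotient.mk (Ideal.span {g₀})) :=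
      hπ' _ (by rw [map_add, map_pow, map_pow]; exact hφ)
    have hX1 : (X 1 : MvPolynomial (Fin 5) k) ∉ Q.comap (Ideal.Quotient.mk (Ideal.span {g₀})) := by
      intro hX1
      have hX0 : (X 0 : MvPolynomial (Fin 5) k) ∈ Q.comap (Ideal.Quotient.mk (Ideal.span {g₀})) := by
        refine hP.mem_of_pow_mem 3 ?_
        have e : (X 0 ^ 3 : MvPolynomial (Fin 5) k) = (X 1 ^ 2 + X 0 ^ 3) - X 1 * X 1 := by ring
        rw [e]; exact Ideal.sub_mem _ hφP (Ideal.mul_mem_left _ _ hX1)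
      obtain ⟨j, hjJ, hjQ⟩ := hj
      apply hjQ
      simp only [Finset.mem_insert, Finset.mem_singleton] at hjJ
      rcases hjJ with rfl | rfl | rfl | rfl
      · exact (key 0).mp hX0
      · exact (key 1).mp hX1
      · exact (key 2).mp hX2
      · exact (key 3).mp hX3
    obtain ⟨Ψ, hΨ0, hΨ1, hΨ2, hΨ3, hΨ4⟩ := RelGddF008ConeData.exists_xytSlicing5 k
    have hy0 : Ψ.symm (X 0) = X 2 := Ψ.symm_apply_eq.mpr hΨ2.symm
    have hy1 : Ψ.symm (X 1) = X 3 := Ψ.symm_apply_eq.mpr hΨ3.symm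
    have hb0 : Ψ.symm (C (X 0)) = X 0 := Ψ.symm_apply_eq.mpr hΨ0.symm
    have hb1 : Ψ.symm (C (X 1)) = X 1 := Ψ.symm_apply_eq.mpr hΨ1.symm
    have hyΨ : ∀ r : Fin 2, Ψ.symm (X r) ∈ Q.comap (Ideal.Quotient.mk (Ideal.span {g₀})) := by
      intro r; fin_cases r
      · exact hy0 ▸ hX2
      · exact hy1 ▸ hX3
    have hΨg : Ψ g₀ = X 0 ^ 2 + (C (X 2 ^ 4 * X 1 ^ 2) * X 1 ^ 4 + C ((X 1 ^ 2 + X 0 ^ 3) ^ 3) + C (X 1 ^ 4) * X 1 ^ 2) := by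
      rw [hg]; simp only [map_add, map_mul, map_pow, hΨ0, hΨ1, hΨ2, hΨ3, hΨ4]; ring
    have hcoeff : coeff (Finsupp.single (0 : Fin 2) (2 * 2) + Finsupp.single 1 4) (Ψ (g₀ ^ (5 - 1))) =
        6 * (2 * (X 2 ^ 4 * X 1 ^ 2) * (X 1 ^ 2 + X 0 ^ 3) ^ 3 + (X 1 ^ 4) ^ 2) ^ 1 := by
      rw [map_pow, hΨg, show (5 - 1 : ℕ) = 4 from rfl, coeff_S1w, pow_one]
    have hdslice : ∀ r : Fin 2, (Finsupp.single (0 : Fin 2) (2 * 2) + Finsupp.single 1 4 : Fin 2 →₀ ℕ) r < 5 := by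
      intro r; fin_cases r <;> simp
    haveI h𝔭 : ((Q.comap (Ideal.Quotient.mk (Ideal.span {g₀}))).comap (Ψ.symm.toRingHom.comp C)).IsPrime := Ideal.comap_isPrime _ _
    have hφ𝔭 : (X 1 ^ 2 + X 0 ^ 3 : MvPolynomial (Fin 3) k) ∈
        (Q.comap (Ideal.Quotient.mk (Ideal.span {g₀}))).comap (Ψ.symm.toRingHom.comp C) := by
      rw [Ideal.mem_comap, RingHom.comp_apply, RingEquiv.toRingHom_eq_coe, RingEquiv.coe_toRingHom, map_add, map_pow, map_pow,
        map_add, map_pow, map_pow, hb0, hb1]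
      exact hφP
    have hnot : (2 * (X 2 ^ 4 * X 1 ^ 2) * (X 1 ^ 2 + X 0 ^ 3) ^ 3 + (X 1 ^ 4) ^ 2 : MvPolynomial (Fin 3) k) ∉
        (Q.comap (Ideal.Quotient.mk (Ideal.span {g₀}))).comap (Ψ.symm.toRingHom.comp C) := by
      intro h
      have h8 : ((X 1 ^ 4) ^ 2 : MvPolynomial (Fin 3) k) ∈
          (Q.comap (Ideal.Quotient.mk (Ideal.span {g₀}))).comap (Ψ.symm.toRingHom.comp C) := by
        have e : ((X 1 ^ 4) ^ 2 : MvPolynomial (Fin 3) k) = (2 * (X 2 ^ 4 * X 1 ^ 2) * (X 1 ^ 2 + X 0 ^ 3) ^ 3 + (X 1 ^ 4) ^ 2)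
            - (2 * (X 2 ^ 4 * X 1 ^ 2) * (X 1 ^ 2 + X 0 ^ 3) ^ 2) * (X 1 ^ 2 + X 0 ^ 3) := by ring
        rw [e]; exact Ideal.sub_mem _ h (Ideal.mul_mem_left _ _ hφ𝔭)
      have h1 := Ideal.mem_comap.mp (h𝔭.mem_of_pow_mem 4 (h𝔭.mem_of_pow_mem 2 h8))
      rw [RingHom.comp_apply, RingEquiv.toRingHom_eq_coe, RingEquiv.coe_toRingHom, hb1] at h1
      exact hX1 h1
    exact FedderViaSlicing.clause_of_sliceCoeff 5 k Ψ g₀ hg0 Q hyΨ _ hdslice _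
      (2 * (X 2 ^ 4 * X 1 ^ 2) * (X 1 ^ 2 + X 0 ^ 3) ^ 3 + (X 1 ^ 4) ^ 2) (hu6 _) 1 (by norm_num) hcoeff (Or.inl hnot) d hd s hs

end Summit.ResolutionOfSingularities.ResolutionOfSingularities.Theorems.FInjectiveMacaulayfication.RelGddF021Cone

end
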